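import Mathlib.Analysis.Calculus.FDeriv.Mul
import Mathlib.Analysis.Calculus.FDeriv.Add
import Mathlib.Analysis.Calculus.ContDiff.Basic
import Mathlib.Analysis.SpecialFunctions.ExpDeriv
import HarnessLib

/-!
# Route `ColdStartUniversality`, crux K_A1 `UniformColdStartMixing` (stmt-QuantumFields-24809), rung `stub_fixedCutoffMixing`:
# G-block, brick G1a — calculus of a second-order generator in coordinates (Leibniz rule, exponentials, ground-state conjugation)

Helper file (seat `ym-line-csu-p1`, g7).  For the coordinate generator appearing in `dynkin_expectation_szz`,
`𝓛 f(y) = Σ_i ∂_{v_i} f(y) b_i + ½ Σ_i Σ_j ∂_{v_j}∂_{v_i} f(y) A_{ij}` (directions `v_i`, drift coefficients `b_i`, diffusion matrix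
`A_{ij} = Σ_n σ_{in} σ_{jn}`), on a real normed space:
* directional first/second derivatives of products and of `exp(c·w)` (`fderiv_mul_apply_dir`, `fderiv_fderiv_mul_apply`,
  `fderiv_exp_const_mul_apply`, `fderiv_fderiv_exp_const_mul_apply`), and of finite linear combinations;
* the Leibniz rule `𝓛(fg) = f 𝓛g + g 𝓛f + Γ(f,g)` with the carré du champ `Γ(f,g) = Σ_{ij} ∂_i f ∂_j g A_{ij}` (`generator_mul`),
  `𝓛(e^{cw}) = e^{cw}(c 𝓛w + ½ c² Γ(w,w))` (`generator_exp_const_mul`), linearity (`generator_sum_smul`);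
* the **ground-state conjugation identity** (`generator_groundState`): if `A` is symmetric and the extra drift is `b¹ = ½ A ∇ψ` (gradient form),
  then `𝓛_{b⁰+b¹}(e^{-ψ/2} w) = e^{-ψ/2} (𝓛_{b⁰} w - V w)` with `V = ½ 𝓛_{b⁰} ψ + ⅛ Γ(ψ,ψ)`, and `𝓛_{b⁰}(e^{ψ/2}) = V e^{ψ/2}`
  (`generator_exp_half`).
Pure calculus; no definition, no sorry.  RECORD-rung R3 plumbing; nothing here bears on the mass gap.
-/

set_option autoImplicit false

noncomputable section

namespace Summit.QuantumFields.YangMills.Theorems.ColdStartUniversality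

open Finset
open scoped BigOperators

variable {E : Type*} [NormedAddCommGroup E] [NormedSpace ℝ E]

/-! ### Directional derivatives of products, exponentials, linear combinations -/

/-- For `C²` `f`, `z ↦ ∂_v f(z)` is differentiable. [folklore] -/
theorem differentiableAt_fderiv_apply_const {f : E → ℝ} (hf : ContDiff ℝ 2 f) (y v : E) :
    DifferentiableAt ℝ (fun z => fderiv ℝ f z v) y := by
  have hd : Differentiable ℝ (fderiv ℝ f) := (hf.fderiv_right (m := 1) (by norm_num)).differentiable (by norm_num)
  exact ((ContinuousLinearMap.apply ℝ ℝ v).differentiable.comp hd).differentiableAt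

/-- `∂_v (fg) = f ∂_v g + g ∂_v f`. [folklore] -/
theorem fderiv_mul_apply_dir {f g : E → ℝ} {y : E} (hf : DifferentiableAt ℝ f y) (hg : DifferentiableAt ℝ g y) (v : E) :
    fderiv ℝ (fun z => f z * g z) y v = f y * fderiv ℝ g y v + g y * fderiv ℝ f y v := by
  rw [fderiv_fun_mul hf hg]
  simp only [add_apply, FunLike.coe_smul, Pi.smul_apply, smul_eq_mul]

/-- `∂_w ∂_u (fg) = f ∂_w∂_u g + g ∂_w∂_u f + ∂_w f ∂_u g + ∂_w g ∂_u f`. [folklore] -/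
theorem fderiv_fderiv_mul_apply {f g : E → ℝ} (hf : ContDiff ℝ 2 f) (hg : ContDiff ℝ 2 g) (y u w : E) :
    fderiv ℝ (fun z => fderiv ℝ (fun z' => f z' * g z') z u) y w =
      f y * fderiv ℝ (fun z => fderiv ℝ g z u) y w + g y * fderiv ℝ (fun z => fderiv ℝ f z u) y w +
        fderiv ℝ f y w * fderiv ℝ g y u + fderiv ℝ g y w * fderiv ℝ f y u := by
  have hfd : Differentiable ℝ f := hf.differentiable (by norm_num)
  have hgd : Differentiable ℝ g := hg.differentiable (by norm_num)
  have h1 : (fun z => fderiv ℝ (fun z' => f z' * g z') z u) =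
      fun z => f z * fderiv ℝ g z u + g z * fderiv ℝ f z u := by
    funext z; exact fderiv_mul_apply_dir (hfd z) (hgd z) u
  rw [h1]
  have hA : DifferentiableAt ℝ (fun z => f z * fderiv ℝ g z u) y :=
    (hfd y).mul (differentiableAt_fderiv_apply_const hg y u)
  have hB : DifferentiableAt ℝ (fun z => g z * fderiv ℝ f z u) y :=
    (hgd y).mul (differentiableAt_fderiv_apply_const hf y u)
  rw [fderiv_fun_add hA hB, add_apply,
    fderiv_mul_apply_dir (hfd y) (differentiableAt_fderiv_apply_const hg y u),
    fderiv_mul_apply_dir (hgd y) (differentiableAt_fderiv_apply_const hf y u)]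
  ring

/-- `∂_v e^{c w} = e^{c w} c ∂_v w`. [folklore] -/
theorem fderiv_exp_const_mul_apply {w : E → ℝ} {y : E} (hw : DifferentiableAt ℝ w y) (c : ℝ) (v : E) :
    fderiv ℝ (fun z => Real.exp (c * w z)) y v = Real.exp (c * w y) * (c * fderiv ℝ w y v) := by
  rw [fderiv_exp (hw.const_mul c), fderiv_const_mul hw]
  simp only [FunLike.coe_smul, Pi.smul_apply, smul_eq_mul]

/-- `∂_v ∂_u e^{c w} = e^{c w} (c ∂_v∂_u w + c² ∂_v w ∂_u w)`. [folklore] -/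
theorem fderiv_fderiv_exp_const_mul_apply {w : E → ℝ} (hw : ContDiff ℝ 2 w) (c : ℝ) (y u v : E) :
    fderiv ℝ (fun z => fderiv ℝ (fun z' => Real.exp (c * w z')) z u) y v =
      Real.exp (c * w y) * (c * fderiv ℝ (fun z => fderiv ℝ w z u) y v + c ^ 2 * (fderiv ℝ w y v * fderiv ℝ w y u)) := by
  have hwd : Differentiable ℝ w := hw.differentiable (by norm_num)
  have h1 : (fun z => fderiv ℝ (fun z' => Real.exp (c * w z')) z u) =
      fun z => Real.exp (c * w z) * (c * fderiv ℝ w z u) := by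
    funext z; exact fderiv_exp_const_mul_apply (hwd z) c u
  rw [h1]
  have hA : DifferentiableAt ℝ (fun z => Real.exp (c * w z)) y := ((hwd y).const_mul c).exp
  have hB : DifferentiableAt ℝ (fun z => c * fderiv ℝ w z u) y :=
    (differentiableAt_fderiv_apply_const hw y u).const_mul c
  rw [fderiv_mul_apply_dir hA hB, fderiv_exp_const_mul_apply (hwd y) c v, fderiv_const_mul
    (differentiableAt_fderiv_apply_const hw y u)]
  simp only [FunLike.coe_smul, Pi.smul_apply, smul_eq_mul]
  ring

/-- `∂_v (Σ_k c_k f_k) = Σ_k c_k ∂_v f_k`. [folklore] -/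
theorem fderiv_sum_mul_apply {J : Type*} (s : Finset J) (c : J → ℝ) {f : J → E → ℝ} {y : E}
    (hf : ∀ k ∈ s, DifferentiableAt ℝ (f k) y) (v : E) :
    fderiv ℝ (fun z => ∑ k ∈ s, c k * f k z) y v = ∑ k ∈ s, c k * fderiv ℝ (f k) y v := by
  have h : HasFDerivAt (fun z => ∑ k ∈ s, c k * f k z) (∑ k ∈ s, c k • fderiv ℝ (f k) y) y :=
    HasFDerivAt.fun_sum fun k hk => ((hf k hk).hasFDerivAt.const_mul (c k))
  rw [h.fderiv, _root_.sum_apply]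
  simp only [FunLike.coe_smul, Pi.smul_apply, smul_eq_mul]

/-- `∂_w ∂_u (Σ_k c_k f_k) = Σ_k c_k ∂_w∂_u f_k`. [folklore] -/
theorem fderiv_fderiv_sum_mul_apply {J : Type*} (s : Finset J) (c : J → ℝ) {f : J → E → ℝ}
    (hf : ∀ k ∈ s, ContDiff ℝ 2 (f k)) (y u w : E) :
    fderiv ℝ (fun z => fderiv ℝ (fun z' => ∑ k ∈ s, c k * f k z') z u) y w =
      ∑ k ∈ s, c k * fderiv ℝ (fun z => fderiv ℝ (f k) z u) y w := by
  have h1 : (fun z => fderiv ℝ (fun z' => ∑ k ∈ s, c k * f k z') z u) =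
      fun z => ∑ k ∈ s, c k * fderiv ℝ (f k) z u := by
    funext z
    exact fderiv_sum_mul_apply s c (fun k hk => ((hf k hk).differentiable (by norm_num)) z) u
  rw [h1]
  exact fderiv_sum_mul_apply s c (fun k hk => differentiableAt_fderiv_apply_const (hf k hk) y u) w

/-! ### The generator: Leibniz rule, exponentials, linearity -/

/-- **Leibniz rule for a second-order generator**: with a symmetric diffusion matrix `A`,
`𝓛(fg) = f 𝓛g + g 𝓛f + Σ_{ij} ∂_i f ∂_j g A_{ij}`. [folklore] -/
theorem generator_mul {ι : Type*} [Fintype ι] (v : ι → E) (b : ι → ℝ) (A : ι → ι → ℝ) (hA : ∀ i j, A i j = A j i)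
    {f g : E → ℝ} (hf : ContDiff ℝ 2 f) (hg : ContDiff ℝ 2 g) (y : E) :
    (∑ i, fderiv ℝ (fun z => f z * g z) y (v i) * b i +
        1 / 2 * ∑ i, ∑ j, fderiv ℝ (fun z => fderiv ℝ (fun z' => f z' * g z') z (v i)) y (v j) * A i j) =
      f y * (∑ i, fderiv ℝ g y (v i) * b i + 1 / 2 * ∑ i, ∑ j, fderiv ℝ (fun z => fderiv ℝ g z (v i)) y (v j) * A i j) +
      g y * (∑ i, fderiv ℝ f y (v i) * b i + 1 / 2 * ∑ i, ∑ j, fderiv ℝ (fun z => fderiv ℝ f z (v i)) y (v j) * A i j) +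
      ∑ i, ∑ j, fderiv ℝ f y (v i) * fderiv ℝ g y (v j) * A i j := by
  have hfd : Differentiable ℝ f := hf.differentiable (by norm_num)
  have hgd : Differentiable ℝ g := hg.differentiable (by norm_num)
  simp_rw [fderiv_mul_apply_dir (hfd y) (hgd y), fderiv_fderiv_mul_apply hf hg]
  -- the mixed terms symmetrise
  have hsym : ∑ i, ∑ j, (fderiv ℝ f y (v j) * fderiv ℝ g y (v i)) * A i j =
      ∑ i, ∑ j, (fderiv ℝ f y (v i) * fderiv ℝ g y (v j)) * A i j := by
    rw [Finset.sum_comm]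
    exact Finset.sum_congr rfl fun i _ => Finset.sum_congr rfl fun j _ => by rw [hA j i]
  have hsplit : ∑ i, ∑ j, (f y * fderiv ℝ (fun z => fderiv ℝ g z (v i)) y (v j) +
      g y * fderiv ℝ (fun z => fderiv ℝ f z (v i)) y (v j) +
      fderiv ℝ f y (v j) * fderiv ℝ g y (v i) + fderiv ℝ g y (v j) * fderiv ℝ f y (v i)) * A i j =
      f y * ∑ i, ∑ j, fderiv ℝ (fun z => fderiv ℝ g z (v i)) y (v j) * A i j +
      g y * ∑ i, ∑ j, fderiv ℝ (fun z => fderiv ℝ f z (v i)) y (v j) * A i j +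
      ∑ i, ∑ j, (fderiv ℝ f y (v j) * fderiv ℝ g y (v i)) * A i j +
      ∑ i, ∑ j, (fderiv ℝ f y (v i) * fderiv ℝ g y (v j)) * A i j := by
    simp only [Finset.mul_sum, ← Finset.sum_add_distrib]
    exact Finset.sum_congr rfl fun i _ => Finset.sum_congr rfl fun j _ => by ring
  have hfirst : ∑ i, (f y * fderiv ℝ g y (v i) + g y * fderiv ℝ f y (v i)) * b i =
      f y * ∑ i, fderiv ℝ g y (v i) * b i + g y * ∑ i, fderiv ℝ f y (v i) * b i := by
    simp only [Finset.mul_sum, ← Finset.sum_add_distrib]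
    exact Finset.sum_congr rfl fun i _ => by ring
  rw [hsplit, hsym, hfirst]
  ring

/-- **Generator of an exponential**: `𝓛(e^{cw}) = e^{cw} (c 𝓛w + ½ c² Γ(w,w))`. [folklore] -/
theorem generator_exp_const_mul {ι : Type*} [Fintype ι] (v : ι → E) (b : ι → ℝ) (A : ι → ι → ℝ)
    {w : E → ℝ} (hw : ContDiff ℝ 2 w) (c : ℝ) (y : E) :
    (∑ i, fderiv ℝ (fun z => Real.exp (c * w z)) y (v i) * b i +
        1 / 2 * ∑ i, ∑ j, fderiv ℝ (fun z => fderiv ℝ (fun z' => Real.exp (c * w z')) z (v i)) y (v j) * A i j) =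
      Real.exp (c * w y) * (c * (∑ i, fderiv ℝ w y (v i) * b i +
          1 / 2 * ∑ i, ∑ j, fderiv ℝ (fun z => fderiv ℝ w z (v i)) y (v j) * A i j) +
        1 / 2 * c ^ 2 * ∑ i, ∑ j, fderiv ℝ w y (v i) * fderiv ℝ w y (v j) * A i j) := by
  have hwd : Differentiable ℝ w := hw.differentiable (by norm_num)
  simp_rw [fderiv_exp_const_mul_apply (hwd y), fderiv_fderiv_exp_const_mul_apply hw]
  have h1 : ∑ i, Real.exp (c * w y) * (c * fderiv ℝ w y (v i)) * b i =
      Real.exp (c * w y) * c * ∑ i, fderiv ℝ w y (v i) * b i := by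
    rw [Finset.mul_sum]; exact Finset.sum_congr rfl fun i _ => by ring
  have h2 : ∑ i, ∑ j, Real.exp (c * w y) * (c * fderiv ℝ (fun z => fderiv ℝ w z (v i)) y (v j) +
      c ^ 2 * (fderiv ℝ w y (v j) * fderiv ℝ w y (v i))) * A i j =
      Real.exp (c * w y) * c * ∑ i, ∑ j, fderiv ℝ (fun z => fderiv ℝ w z (v i)) y (v j) * A i j +
      Real.exp (c * w y) * c ^ 2 * ∑ i, ∑ j, fderiv ℝ w y (v i) * fderiv ℝ w y (v j) * A i j := by
    simp only [Finset.mul_sum]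
    rw [← Finset.sum_add_distrib]
    refine Finset.sum_congr rfl fun i _ => ?_
    rw [← Finset.sum_add_distrib]
    exact Finset.sum_congr rfl fun j _ => by ring
  rw [h1, h2]; ring

/-- **Linearity of the generator** on finite linear combinations. [folklore] -/
theorem generator_sum_mul {ι J : Type*} [Fintype ι] (v : ι → E) (b : ι → ℝ) (A : ι → ι → ℝ)
    (s : Finset J) (c : J → ℝ) {f : J → E → ℝ} (hf : ∀ k ∈ s, ContDiff ℝ 2 (f k)) (y : E) :
    (∑ i, fderiv ℝ (fun z => ∑ k ∈ s, c k * f k z) y (v i) * b i +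
        1 / 2 * ∑ i, ∑ j, fderiv ℝ (fun z => fderiv ℝ (fun z' => ∑ k ∈ s, c k * f k z') z (v i)) y (v j) * A i j) =
      ∑ k ∈ s, c k * (∑ i, fderiv ℝ (f k) y (v i) * b i +
        1 / 2 * ∑ i, ∑ j, fderiv ℝ (fun z => fderiv ℝ (f k) z (v i)) y (v j) * A i j) := by
  simp_rw [fderiv_sum_mul_apply s c (fun k hk => ((hf k hk).differentiable (by norm_num)) y),
    fderiv_fderiv_sum_mul_apply s c hf]
  have h1 : ∑ i, (∑ k ∈ s, c k * fderiv ℝ (f k) y (v i)) * b i =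
      ∑ k ∈ s, c k * ∑ i, fderiv ℝ (f k) y (v i) * b i := by
    calc ∑ i, (∑ k ∈ s, c k * fderiv ℝ (f k) y (v i)) * b i
        = ∑ i, ∑ k ∈ s, c k * (fderiv ℝ (f k) y (v i) * b i) := by
          refine Finset.sum_congr rfl fun i _ => ?_
          rw [Finset.sum_mul]
          exact Finset.sum_congr rfl fun k _ => by ring
      _ = ∑ k ∈ s, ∑ i, c k * (fderiv ℝ (f k) y (v i) * b i) := Finset.sum_comm
      _ = ∑ k ∈ s, c k * ∑ i, fderiv ℝ (f k) y (v i) * b i :=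
          Finset.sum_congr rfl fun k _ => by rw [Finset.mul_sum]
  have h2 : ∑ i, ∑ j, (∑ k ∈ s, c k * fderiv ℝ (fun z => fderiv ℝ (f k) z (v i)) y (v j)) * A i j =
      ∑ k ∈ s, c k * ∑ i, ∑ j, fderiv ℝ (fun z => fderiv ℝ (f k) z (v i)) y (v j) * A i j := by
    calc ∑ i, ∑ j, (∑ k ∈ s, c k * fderiv ℝ (fun z => fderiv ℝ (f k) z (v i)) y (v j)) * A i j
        = ∑ i, ∑ j, ∑ k ∈ s, c k * (fderiv ℝ (fun z => fderiv ℝ (f k) z (v i)) y (v j) * A i j) := by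
          refine Finset.sum_congr rfl fun i _ => Finset.sum_congr rfl fun j _ => ?_
          rw [Finset.sum_mul]
          exact Finset.sum_congr rfl fun k _ => by ring
      _ = ∑ i, ∑ k ∈ s, ∑ j, c k * (fderiv ℝ (fun z => fderiv ℝ (f k) z (v i)) y (v j) * A i j) :=
          Finset.sum_congr rfl fun i _ => Finset.sum_comm
      _ = ∑ k ∈ s, ∑ i, ∑ j, c k * (fderiv ℝ (fun z => fderiv ℝ (f k) z (v i)) y (v j) * A i j) := Finset.sum_comm
      _ = ∑ k ∈ s, c k * ∑ i, ∑ j, fderiv ℝ (fun z => fderiv ℝ (f k) z (v i)) y (v j) * A i j := by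
          refine Finset.sum_congr rfl fun k _ => ?_
          rw [Finset.mul_sum]
          exact Finset.sum_congr rfl fun i _ => by rw [Finset.mul_sum]
  rw [h1, h2, Finset.mul_sum, ← Finset.sum_add_distrib]
  exact Finset.sum_congr rfl fun k _ => by ring

/-! ### The ground-state conjugation -/

/-- **Ground-state conjugation identity.** If the additional drift is of gradient form `b¹_i = ½ Σ_j A_{ij} ∂_j ψ` with
`A_{ij} = Σ_n σ_{in} σ_{jn}` (SZZ Lemma 3.1), then for `φ = e^{-ψ/2}`:
`𝓛_{b⁰+b¹}(φ w) = φ (𝓛_{b⁰} w - V w)`, `V = ½ 𝓛_{b⁰} ψ + ⅛ Γ(ψ,ψ)`, `Γ(ψ,ψ) = Σ_{ij} ∂_i ψ ∂_j ψ A_{ij}`. [folklore] -/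
theorem generator_groundState {ι : Type*} [Fintype ι] (v : ι → E) (b₀ b₁ : ι → ℝ) (A : ι → ι → ℝ)
    (hA : ∀ i j, A i j = A j i) {ψ w : E → ℝ} (hψ : ContDiff ℝ 2 ψ) (hw : ContDiff ℝ 2 w) (y : E)
    (hb₁ : ∀ i, b₁ i = 1 / 2 * ∑ j, A i j * fderiv ℝ ψ y (v j)) :
    (∑ i, fderiv ℝ (fun z => Real.exp (-(1 / 2 : ℝ) * ψ z) * w z) y (v i) * (b₀ i + b₁ i) +
        1 / 2 * ∑ i, ∑ j, fderiv ℝ (fun z => fderiv ℝ (fun z' => Real.exp (-(1 / 2 : ℝ) * ψ z') * w z') z (v i)) y (v j) *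
          A i j) =
      Real.exp (-(1 / 2 : ℝ) * ψ y) *
        ((∑ i, fderiv ℝ w y (v i) * b₀ i +
            1 / 2 * ∑ i, ∑ j, fderiv ℝ (fun z => fderiv ℝ w z (v i)) y (v j) * A i j) -
          (1 / 2 * (∑ i, fderiv ℝ ψ y (v i) * b₀ i +
              1 / 2 * ∑ i, ∑ j, fderiv ℝ (fun z => fderiv ℝ ψ z (v i)) y (v j) * A i j) +
            1 / 8 * ∑ i, ∑ j, fderiv ℝ ψ y (v i) * fderiv ℝ ψ y (v j) * A i j) * w y) := by
  set c : ℝ := -(1 / 2 : ℝ) with hc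
  have hφ : ContDiff ℝ 2 (fun z => Real.exp (c * ψ z)) := Real.contDiff_exp.comp (contDiff_const.mul hψ)
  have hψd : Differentiable ℝ ψ := hψ.differentiable (by norm_num)
  have hwd : Differentiable ℝ w := hw.differentiable (by norm_num)
  have hφd : Differentiable ℝ (fun z => Real.exp (c * ψ z)) := hφ.differentiable (by norm_num)
  -- Step A: split off the extra drift
  have hsplitA : ∑ i, fderiv ℝ (fun z => Real.exp (c * ψ z) * w z) y (v i) * (b₀ i + b₁ i) =
      ∑ i, fderiv ℝ (fun z => Real.exp (c * ψ z) * w z) y (v i) * b₀ i +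
      ∑ i, fderiv ℝ (fun z => Real.exp (c * ψ z) * w z) y (v i) * b₁ i := by
    rw [← Finset.sum_add_distrib]; exact Finset.sum_congr rfl fun i _ => by ring
  -- Step B: Leibniz
  have hB := generator_mul v b₀ A hA hφ hw y
  -- Step C: generator of the exponential
  have hC := generator_exp_const_mul v b₀ A hψ c y
  -- Step D: carré du champ with the exponential
  have hD : ∑ i, ∑ j, fderiv ℝ (fun z => Real.exp (c * ψ z)) y (v i) * fderiv ℝ w y (v j) * A i j =
      Real.exp (c * ψ y) * c * ∑ i, ∑ j, fderiv ℝ ψ y (v i) * fderiv ℝ w y (v j) * A i j := by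
    simp_rw [fderiv_exp_const_mul_apply (hψd y)]
    simp only [Finset.mul_sum]
    exact Finset.sum_congr rfl fun i _ => Finset.sum_congr rfl fun j _ => by ring
  -- Step E: the extra drift term
  have hE : ∑ i, fderiv ℝ (fun z => Real.exp (c * ψ z) * w z) y (v i) * b₁ i =
      Real.exp (c * ψ y) * (1 / 2) * ∑ i, ∑ j, fderiv ℝ w y (v i) * fderiv ℝ ψ y (v j) * A i j +
      Real.exp (c * ψ y) * c * w y * (1 / 2) *
        ∑ i, ∑ j, fderiv ℝ ψ y (v i) * fderiv ℝ ψ y (v j) * A i j := by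
    simp_rw [fderiv_mul_apply_dir (hφd y) (hwd y), fderiv_exp_const_mul_apply (hψd y), hb₁]
    simp only [Finset.mul_sum]
    rw [← Finset.sum_add_distrib]
    refine Finset.sum_congr rfl fun i _ => ?_
    rw [← Finset.sum_add_distrib]
    exact Finset.sum_congr rfl fun j _ => by ring
  -- Step F: symmetry of the carré du champ
  have hF : ∑ i, ∑ j, fderiv ℝ w y (v i) * fderiv ℝ ψ y (v j) * A i j =
      ∑ i, ∑ j, fderiv ℝ ψ y (v i) * fderiv ℝ w y (v j) * A i j := by
    rw [Finset.sum_comm]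
    exact Finset.sum_congr rfl fun i _ => Finset.sum_congr rfl fun j _ => by rw [hA i j]; ring
  rw [hsplitA, add_right_comm, hB, hC, hD, hE, hF]
  rw [hc]; ring

/-- **Generator of the inverse ground state**: `𝓛(e^{ψ/2}) = V e^{ψ/2}` with `V = ½ 𝓛ψ + ⅛ Γ(ψ,ψ)`. [folklore] -/
theorem generator_exp_half {ι : Type*} [Fintype ι] (v : ι → E) (b : ι → ℝ) (A : ι → ι → ℝ)
    {ψ : E → ℝ} (hψ : ContDiff ℝ 2 ψ) (y : E) :
    (∑ i, fderiv ℝ (fun z => Real.exp ((1 / 2 : ℝ) * ψ z)) y (v i) * b i +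
        1 / 2 * ∑ i, ∑ j, fderiv ℝ (fun z => fderiv ℝ (fun z' => Real.exp ((1 / 2 : ℝ) * ψ z')) z (v i)) y (v j) * A i j) =
      (1 / 2 * (∑ i, fderiv ℝ ψ y (v i) * b i + 1 / 2 * ∑ i, ∑ j, fderiv ℝ (fun z => fderiv ℝ ψ z (v i)) y (v j) * A i j) +
          1 / 8 * ∑ i, ∑ j, fderiv ℝ ψ y (v i) * fderiv ℝ ψ y (v j) * A i j) *
        Real.exp ((1 / 2 : ℝ) * ψ y) := by
  rw [generator_exp_const_mul v b A hψ (1 / 2) y]; ring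

end Summit.QuantumFields.YangMills.Theorems.ColdStartUniversality

end
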